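import Mathlib
import Summits.Schanuel.Schanuel.Theorems.RigidCoreMinimalCounterexampleInAclHitSetBoxArith

/-!
# Ring-definable families of complex numbers: products, norms, polynomial evaluation
# (crux stmt-Schanuel-0969 `RigidCore.MinimalCounterexampleInAcl`, line kernel-arithmetic-selection, stub S8‴)

`--supports stmt-Schanuel-0969`; second foundation layer under `stub_corankOne_hitSetRingDefinable` (S8‴), continuing
`…HitSetBoxArith.lean`: a family `f : (σ → ℤ) → ℝ` is RING-DEFINABLE when its strict lower rational cut
`{(v, p, r) : 0 < r ∧ p / r < f v}` is `∅`-definable in the ring `ℤ` (written out in every statement); a complex family is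
ring-definable when its real and imaginary parts are (a conjunction of two cuts).  This file proves:

* PRODUCTS of ring-definable real families (`defR_mul`: `p/r < f g` iff a rational box `(a₁, a₂] × (b₁, b₂] ∋ (f, g)` has its
  four corner products above `p/r` — interval ("box") multiplication);
* complex families: Gaussian-rational points `(a + b i)/c` of definable integer coordinates, integer parameters, rational
  constants, sums, products, finite sums, the squared norm (`defC_testPoint`, `defC_add`, `defC_mul`, `defR_normSq`, …);
* EVALUATION OF FIXED POLYNOMIALS: `v ↦ aeval (X v) p` for `p ∈ ℚ[ι]` (`MvPolynomial`) or `p ∈ ℚ[T]` at ring-definable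
  complex families is ring-definable (`defC_mvPolynomial_aeval`, `defC_polynomial_aeval`).

Registered helper stub: `ringDefinable_realCut_mul` (explicit form of `defR_mul`).

References: K. Weihrauch, *Computable Analysis* (2000), §4.1; R. E. Moore, *Interval Analysis* (1966), Ch. 2 (interval
product by corner values).
-/

-- the summit namespace `Summit.Schanuel.Schanuel.…` repeats a component by design (D-0022)
set_option linter.dupNamespace false

open Set FirstOrder FirstOrder.Language Filter Topology Complex

namespace Summit.Schanuel.Schanuel.Cruxes.MinimalCounterexampleInAcl.KernelArithmeticSelection

open Literature.ModelTheory.ExponentialFields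

/-! ## Products of real families -/

/-- The four corner products of a box bound a product from below. -/
theorem corner_lt_mul {f g a₁ a₂ b₁ b₂ t : ℝ} (ha₁ : a₁ < f) (ha₂ : f ≤ a₂) (hb₁ : b₁ < g) (hb₂ : g ≤ b₂)
    (h₁₁ : t < a₁ * b₁) (h₁₂ : t < a₁ * b₂) (h₂₁ : t < a₂ * b₁) (h₂₂ : t < a₂ * b₂) : t < f * g := by
  have key : ∀ a : ℝ, t < a * b₁ → t < a * b₂ → t < a * g := by
    intro a h1 h2
    rcases le_or_gt 0 a with ha | ha
    · exact h1.trans_le (mul_le_mul_of_nonneg_left hb₁.le ha)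
    · exact h2.trans_le (mul_le_mul_of_nonpos_left hb₂ ha.le)
  rcases le_or_gt 0 g with hg | hg
  · exact (key a₁ h₁₁ h₁₂).trans_le (mul_le_mul_of_nonneg_right ha₁.le hg)
  · exact (key a₂ h₂₁ h₂₂).trans_le (mul_le_mul_of_nonpos_right ha₂ hg.le)

/-- Continuity of multiplication at a point, corner form: if `t < f · g` then all products of reals close enough to `f` and
`g` stay above `t`. -/
theorem exists_delta_corner {f g t : ℝ} (h : t < f * g) :
    ∃ δ : ℝ, 0 < δ ∧ ∀ a b : ℝ, |a - f| ≤ δ → |b - g| ≤ δ → t < a * b := by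
  have hc : ContinuousAt (fun x : ℝ × ℝ => x.1 * x.2) (f, g) :=
    (continuous_fst.mul continuous_snd).continuousAt
  rw [Metric.continuousAt_iff] at hc
  obtain ⟨δ, hδ, hδ'⟩ := hc (f * g - t) (by linarith)
  refine ⟨δ / 2, by linarith, fun a b ha hb => ?_⟩
  have hd : dist (a, b) (f, g) < δ := by
    rw [Prod.dist_eq, Real.dist_eq, Real.dist_eq]
    exact max_lt (by linarith [abs_nonneg (a - f)]) (by linarith [abs_nonneg (b - g)])
  have := hδ' hd
  rw [Real.dist_eq] at this
  have := (abs_lt.1 this).1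
  linarith

/-- Integer box of mesh `1 / d` around a real: `(⌈a d⌉ - 1) / d < a ≤ ⌈a d⌉ / d`, both within `1 / d` of `a`. -/
theorem ceil_box (a : ℝ) {d : ℤ} (hd : 0 < d) :
    ((⌈a * d⌉ - 1 : ℤ) : ℝ) / d < a ∧ a ≤ ((⌈a * d⌉ : ℤ) : ℝ) / d ∧
      |((⌈a * d⌉ - 1 : ℤ) : ℝ) / d - a| ≤ 1 / d ∧ |((⌈a * d⌉ : ℤ) : ℝ) / d - a| ≤ 1 / d := by
  have hd' : (0 : ℝ) < d := by exact_mod_cast hd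
  have h1 : ((⌈a * d⌉ - 1 : ℤ) : ℝ) / d < a := by
    rw [div_lt_iff₀ hd']; push_cast; linarith [Int.ceil_lt_add_one (a * d)]
  have h2 : a ≤ ((⌈a * d⌉ : ℤ) : ℝ) / d := by
    rw [le_div_iff₀ hd']; exact Int.le_ceil _
  have h3 : ((⌈a * d⌉ : ℤ) : ℝ) / d = ((⌈a * d⌉ - 1 : ℤ) : ℝ) / d + 1 / d := by
    push_cast; ring
  refine ⟨h1, h2, ?_, ?_⟩
  · rw [abs_sub_comm, abs_of_nonneg (by linarith)]; linarith
  · rw [abs_of_nonneg (by linarith)]; linarith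

variable [FirstOrder.Ring.CompatibleRing ℤ] {σ τ : Type*}

/-- **Products of ring-definable real families are ring-definable**: `p/r < f g` iff some rational box
`(a₁, a₂] × (b₁, b₂] ∋ (f, g)` of common denominator has all four corner products above `p/r`. [folklore] -/
theorem defR_mul {f g : (σ → ℤ) → ℝ} (hf : (∅ : Set ℤ).Definable Language.ring {w : _ ⊕ Fin 2 → ℤ | 0 < w (Sum.inr 1) ∧ ((w (Sum.inr 0) : ℤ) : ℝ) < ((w (Sum.inr 1) : ℤ) : ℝ) * (f ∘ fun w' s => w' (Sum.inl s)) w}) (hg : (∅ : Set ℤ).Definable Language.ring {w : _ ⊕ Fin 2 → ℤ | 0 < w (Sum.inr 1) ∧ ((w (Sum.inr 0) : ℤ) : ℝ) < ((w (Sum.inr 1) : ℤ) : ℝ) * (g ∘ fun w' s => w' (Sum.inl s)) w}) : (∅ : Set ℤ).Definable Language.ring {w : _ ⊕ Fin 2 → ℤ | 0 < w (Sum.inr 1) ∧ ((w (Sum.inr 0) : ℤ) : ℝ) < ((w (Sum.inr 1) : ℤ) : ℝ) * ((fun v => f v * g v) ∘ fun w' s => w' (Sum.inl s)) w} := by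
  have h : (∅ : Set ℤ).Definable Language.ring {w : σ ⊕ Fin 2 → ℤ | 0 < w (Sum.inr 1) ∧ ∃ u : Fin 5 → ℤ,
      (0 < u 4 ∧ ((u 0 : ℤ) : ℝ) < ((u 4 : ℤ) : ℝ) * f (fun s => w (Sum.inl s))) ∧
      ¬ (0 < u 4 ∧ ((u 1 : ℤ) : ℝ) < ((u 4 : ℤ) : ℝ) * f (fun s => w (Sum.inl s))) ∧
      (0 < u 4 ∧ ((u 2 : ℤ) : ℝ) < ((u 4 : ℤ) : ℝ) * g (fun s => w (Sum.inl s))) ∧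
      ¬ (0 < u 4 ∧ ((u 3 : ℤ) : ℝ) < ((u 4 : ℤ) : ℝ) * g (fun s => w (Sum.inl s))) ∧
      w (Sum.inr 0) * u 4 * u 4 < w (Sum.inr 1) * (u 0 * u 2) ∧ w (Sum.inr 0) * u 4 * u 4 < w (Sum.inr 1) * (u 0 * u 3) ∧
      w (Sum.inr 0) * u 4 * u 4 < w (Sum.inr 1) * (u 1 * u 2) ∧ w (Sum.inr 0) * u 4 * u 4 < w (Sum.inr 1) * (u 1 * u 3)} := by
    have hc : ∀ i j : Fin 5, (∅ : Set ℤ).Definable Language.ring {w : (σ ⊕ Fin 2) ⊕ Fin 5 → ℤ |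
        w (Sum.inl (Sum.inr 0)) * w (Sum.inr 4) * w (Sum.inr 4) < w (Sum.inl (Sum.inr 1)) * (w (Sum.inr i) * w (Sum.inr j))} :=
      fun i j => ringDefinable_setOf_lt
        (ringDefinableFun_mul (ringDefinableFun_mul (definableFun_proj_params _) (definableFun_proj_params _))
          (definableFun_proj_params _))
        (ringDefinableFun_mul (definableFun_proj_params _)
          (ringDefinableFun_mul (definableFun_proj_params _) (definableFun_proj_params _)))
    refine definable_setOf_and_params (ringDefinable_setOf_lt ringDefinableFun_zero (definableFun_proj_params _))
      (definable_setOf_existsBlock (definable_setOf_and_params ?_ (definable_setOf_and_params ?_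
        (definable_setOf_and_params ?_ (definable_setOf_and_params ?_ (definable_setOf_and_params (hc 0 2)
        (definable_setOf_and_params (hc 0 3) (definable_setOf_and_params (hc 1 2) (hc 1 3)))))))))
    · exact defR_atom hf (fun s => Sum.inl (Sum.inl s)) (Sum.inr 0) (Sum.inr 4)
    · exact definable_setOf_not_params (defR_atom hf (fun s => Sum.inl (Sum.inl s)) (Sum.inr 1) (Sum.inr 4))
    · exact defR_atom hg (fun s => Sum.inl (Sum.inl s)) (Sum.inr 2) (Sum.inr 4)
    · exact definable_setOf_not_params (defR_atom hg (fun s => Sum.inl (Sum.inl s)) (Sum.inr 3) (Sum.inr 4))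
  convert h using 1
  ext w
  simp only [mem_setOf_eq, Function.comp_apply]
  refine and_congr_right fun hr => ?_
  set p := w (Sum.inr 0)
  set r := w (Sum.inr 1)
  set a := f (fun s => w (Sum.inl s))
  set b := g (fun s => w (Sum.inl s))
  have hr' : (0 : ℝ) < r := by exact_mod_cast hr
  -- the integer corner condition says `p / r < uᵢ uⱼ / d²`
  have corner : ∀ {d x y : ℤ}, 0 < d →
      (p * d * d < r * (x * y) ↔ (p : ℝ) / r < ((x : ℝ) / d) * ((y : ℝ) / d)) := by
    intro d x y hd
    have hd' : (0 : ℝ) < d := by exact_mod_cast hd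
    rw [div_mul_div_comm, div_lt_div_iff₀ hr' (mul_pos hd' hd')]
    constructor
    · intro h
      have h' : ((p * d * d : ℤ) : ℝ) < ((r * (x * y) : ℤ) : ℝ) := by exact_mod_cast h
      push_cast at h'; linarith
    · intro h
      have h' : (p : ℝ) * d * d < r * (x * y) := by linarith
      exact_mod_cast h'
  constructor
  · intro hlt
    rw [← int_div_lt_iff hr] at hlt
    obtain ⟨δ, hδ, hδ'⟩ := exists_delta_corner hlt
    obtain ⟨n, hn⟩ := exists_nat_one_div_lt hδ
    set d : ℤ := (n : ℤ) + 1 with hd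
    have hd0 : 0 < d := by rw [hd]; positivity
    have hdd : (1 : ℝ) / d ≤ δ := by
      rw [hd]; push_cast; exact hn.le
    obtain ⟨ha₁, ha₂, ha₁', ha₂'⟩ := ceil_box a hd0
    obtain ⟨hb₁, hb₂, hb₁', hb₂'⟩ := ceil_box b hd0
    refine ⟨![⌈a * d⌉ - 1, ⌈a * d⌉, ⌈b * d⌉ - 1, ⌈b * d⌉, d], ⟨hd0, ?_⟩, fun ⟨_, h2⟩ => ?_, ⟨hd0, ?_⟩, fun ⟨_, h4⟩ => ?_,
      ?_, ?_, ?_, ?_⟩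
    · simp only [Matrix.cons_val_zero, Matrix.cons_val]; rwa [← int_div_lt_iff hd0]
    · simp only [Matrix.cons_val_one, Matrix.cons_val] at h2
      rw [← int_div_lt_iff hd0] at h2; linarith
    · simp only [Matrix.cons_val]; rwa [← int_div_lt_iff hd0]
    · simp only [Matrix.cons_val] at h4
      rw [← int_div_lt_iff hd0] at h4; linarith
    all_goals simp only [Matrix.cons_val_zero, Matrix.cons_val_one, Matrix.cons_val]
    · exact (corner hd0).2 (hδ' _ _ (ha₁'.trans hdd) (hb₁'.trans hdd))
    · exact (corner hd0).2 (hδ' _ _ (ha₁'.trans hdd) (hb₂'.trans hdd))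
    · exact (corner hd0).2 (hδ' _ _ (ha₂'.trans hdd) (hb₁'.trans hdd))
    · exact (corner hd0).2 (hδ' _ _ (ha₂'.trans hdd) (hb₂'.trans hdd))
  · rintro ⟨u, ⟨hd0, h₁⟩, h₂, ⟨-, h₃⟩, h₄, c₁, c₂, c₃, c₄⟩
    have h₂' : ¬ ((u 1 : ℤ) : ℝ) < ((u 4 : ℤ) : ℝ) * a := fun h => h₂ ⟨hd0, h⟩
    have h₄' : ¬ ((u 3 : ℤ) : ℝ) < ((u 4 : ℤ) : ℝ) * b := fun h => h₄ ⟨hd0, h⟩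
    rw [← int_div_lt_iff hd0, not_lt] at h₂' h₄'
    rw [← int_div_lt_iff hd0] at h₁ h₃
    rw [← int_div_lt_iff hr]
    exact corner_lt_mul h₁ h₂' h₃ h₄' ((corner hd0).1 c₁) ((corner hd0).1 c₂) ((corner hd0).1 c₃) ((corner hd0).1 c₄)

/-- Finite products of ring-definable real families are ring-definable. [folklore] -/
theorem defR_prod {ι : Type*} (s : Finset ι) {F : ι → (σ → ℤ) → ℝ} (hF : ∀ i ∈ s, (∅ : Set ℤ).Definable Language.ring {w : _ ⊕ Fin 2 → ℤ | 0 < w (Sum.inr 1) ∧ ((w (Sum.inr 0) : ℤ) : ℝ) < ((w (Sum.inr 1) : ℤ) : ℝ) * ((F i) ∘ fun w' s => w' (Sum.inl s)) w}) :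
    (∅ : Set ℤ).Definable Language.ring {w : _ ⊕ Fin 2 → ℤ | 0 < w (Sum.inr 1) ∧ ((w (Sum.inr 0) : ℤ) : ℝ) < ((w (Sum.inr 1) : ℤ) : ℝ) * ((fun v => ∏ i ∈ s, F i v) ∘ fun w' s => w' (Sum.inl s)) w} := by
  classical
  induction s using Finset.induction_on with
  | empty => exact defR_congr (defR_intCast (ringDefinableFun_one (α := σ))) fun v => by simp
  | insert i s hi ih =>
    exact defR_congr (defR_mul (hF i (Finset.mem_insert_self i s))
      (ih fun j hj => hF j (Finset.mem_insert_of_mem hj))) fun v => by simp [Finset.prod_insert hi]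

/-- Natural powers of a ring-definable real family are ring-definable. [folklore] -/
theorem defR_pow {f : (σ → ℤ) → ℝ} (hf : (∅ : Set ℤ).Definable Language.ring {w : _ ⊕ Fin 2 → ℤ | 0 < w (Sum.inr 1) ∧ ((w (Sum.inr 0) : ℤ) : ℝ) < ((w (Sum.inr 1) : ℤ) : ℝ) * (f ∘ fun w' s => w' (Sum.inl s)) w}) (n : ℕ) : (∅ : Set ℤ).Definable Language.ring {w : _ ⊕ Fin 2 → ℤ | 0 < w (Sum.inr 1) ∧ ((w (Sum.inr 0) : ℤ) : ℝ) < ((w (Sum.inr 1) : ℤ) : ℝ) * ((fun v => f v ^ n) ∘ fun w' s => w' (Sum.inl s)) w} := by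
  induction n with
  | zero => exact defR_congr (defR_intCast (ringDefinableFun_one (α := σ))) fun v => by simp
  | succ n ih => exact defR_congr (defR_mul ih hf) fun v => by simp [pow_succ]

/-! ## Complex families -/

/-- Ring-definability of a complex family depends only on its values. -/
theorem defC_congr {f g : (σ → ℤ) → ℂ} (hf : ((∅ : Set ℤ).Definable Language.ring {w : _ ⊕ Fin 2 → ℤ | 0 < w (Sum.inr 1) ∧ ((w (Sum.inr 0) : ℤ) : ℝ) < ((w (Sum.inr 1) : ℤ) : ℝ) * ((Complex.re ∘ f) ∘ fun w' s => w' (Sum.inl s)) w} ∧ (∅ : Set ℤ).Definable Language.ring {w : _ ⊕ Fin 2 → ℤ | 0 < w (Sum.inr 1) ∧ ((w (Sum.inr 0) : ℤ) : ℝ) < ((w (Sum.inr 1) : ℤ) : ℝ) * ((Complex.im ∘ f) ∘ fun w' s => w' (Sum.inl s)) w})) (h : ∀ v, f v = g v) : ((∅ : Set ℤ).Definable Language.ring {w : _ ⊕ Fin 2 → ℤ | 0 < w (Sum.inr 1) ∧ ((w (Sum.inr 0) : ℤ) : ℝ) < ((w (Sum.inr 1) : ℤ) : ℝ) * ((Complex.re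 ∘ g) ∘ fun w' s => w' (Sum.inl s)) w} ∧ (∅ : Set ℤ).Definable Language.ring {w : _ ⊕ Fin 2 → ℤ | 0 < w (Sum.inr 1) ∧ ((w (Sum.inr 0) : ℤ) : ℝ) < ((w (Sum.inr 1) : ℤ) : ℝ) * ((Complex.im ∘ g) ∘ fun w' s => w' (Sum.inl s)) w}) := by
  have e : f = g := funext h
  subst e; exact hf

/-- A complex family given by ring-definable real and imaginary parts is ring-definable. [folklore] -/
theorem defC_mk {f : (σ → ℤ) → ℂ} (hre : (∅ : Set ℤ).Definable Language.ring {w : _ ⊕ Fin 2 → ℤ | 0 < w (Sum.inr 1) ∧ ((w (Sum.inr 0) : ℤ) : ℝ) < ((w (Sum.inr 1) : ℤ) : ℝ) * ((fun v => (f v).re) ∘ fun w' s => w' (Sum.inl s)) w}) (him : (∅ : Set ℤ).Definable Language.ring {w : _ ⊕ Fin 2 → ℤ | 0 < w (Sum.inr 1) ∧ ((w (Sum.inr 0) : ℤ) : ℝ) < ((w (Sum.inr 1) : ℤ) : ℝ) * ((fun v => (f v).im) ∘ fun w' s => w' (Sum.inl s)) w}) : ((∅ : Set ℤ).Definable Language.ring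 {w : _ ⊕ Fin 2 → ℤ | 0 < w (Sum.inr 1) ∧ ((w (Sum.inr 0) : ℤ) : ℝ) < ((w (Sum.inr 1) : ℤ) : ℝ) * ((Complex.re ∘ f) ∘ fun w' s => w' (Sum.inl s)) w} ∧ (∅ : Set ℤ).Definable Language.ring {w : _ ⊕ Fin 2 → ℤ | 0 < w (Sum.inr 1) ∧ ((w (Sum.inr 0) : ℤ) : ℝ) < ((w (Sum.inr 1) : ℤ) : ℝ) * ((Complex.im ∘ f) ∘ fun w' s => w' (Sum.inl s)) w}) :=
  ⟨hre, him⟩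

/-- The real part of a ring-definable complex family. [folklore] -/
theorem defC_re {f : (σ → ℤ) → ℂ} (hf : ((∅ : Set ℤ).Definable Language.ring {w : _ ⊕ Fin 2 → ℤ | 0 < w (Sum.inr 1) ∧ ((w (Sum.inr 0) : ℤ) : ℝ) < ((w (Sum.inr 1) : ℤ) : ℝ) * ((Complex.re ∘ f) ∘ fun w' s => w' (Sum.inl s)) w} ∧ (∅ : Set ℤ).Definable Language.ring {w : _ ⊕ Fin 2 → ℤ | 0 < w (Sum.inr 1) ∧ ((w (Sum.inr 0) : ℤ) : ℝ) < ((w (Sum.inr 1) : ℤ) : ℝ) * ((Complex.im ∘ f) ∘ fun w' s => w' (Sum.inl s)) w})) : (∅ : Set ℤ).Definable Language.ring {w : _ ⊕ Fin 2 → ℤ | 0 < w (Sum.inr 1) ∧ ((w (Sum.inr 0) : ℤ) : ℝ) < ((w (Sum.inr 1) : ℤ) : ℝ) * ((fun v => (f v).re) ∘ fun w' s => w' (Sum.inl s)) w} := hf.1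

/-- The imaginary part of a ring-definable complex family. [folklore] -/
theorem defC_im {f : (σ → ℤ) → ℂ} (hf : ((∅ : Set ℤ).Definable Language.ring {w : _ ⊕ Fin 2 → ℤ | 0 < w (Sum.inr 1) ∧ ((w (Sum.inr 0) : ℤ) : ℝ) < ((w (Sum.inr 1) : ℤ) : ℝ) * ((Complex.re ∘ f) ∘ fun w' s => w' (Sum.inl s)) w} ∧ (∅ : Set ℤ).Definable Language.ring {w : _ ⊕ Fin 2 → ℤ | 0 < w (Sum.inr 1) ∧ ((w (Sum.inr 0) : ℤ) : ℝ) < ((w (Sum.inr 1) : ℤ) : ℝ) * ((Complex.im ∘ f) ∘ fun w' s => w' (Sum.inl s)) w})) : (∅ : Set ℤ).Definable Language.ring {w : _ ⊕ Fin 2 → ℤ | 0 < w (Sum.inr 1) ∧ ((w (Sum.inr 0) : ℤ) : ℝ) < ((w (Sum.inr 1) : ℤ) : ℝ) * ((fun v => (f v).im) ∘ fun w' s => w' (Sum.inl s)) w} := hf.2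

/-- Reindexing a ring-definable complex family. [folklore] -/
theorem defC_reindex {f : (σ → ℤ) → ℂ} (hf : ((∅ : Set ℤ).Definable Language.ring {w : _ ⊕ Fin 2 → ℤ | 0 < w (Sum.inr 1) ∧ ((w (Sum.inr 0) : ℤ) : ℝ) < ((w (Sum.inr 1) : ℤ) : ℝ) * ((Complex.re ∘ f) ∘ fun w' s => w' (Sum.inl s)) w} ∧ (∅ : Set ℤ).Definable Language.ring {w : _ ⊕ Fin 2 → ℤ | 0 < w (Sum.inr 1) ∧ ((w (Sum.inr 0) : ℤ) : ℝ) < ((w (Sum.inr 1) : ℤ) : ℝ) * ((Complex.im ∘ f) ∘ fun w' s => w' (Sum.inl s)) w})) (ρ : σ → τ) : ((∅ : Set ℤ).Definable Language.ring {w : _ ⊕ Fin 2 → ℤ | 0 < w (Sum.inr 1) ∧ ((w (Sum.inr 0) : ℤ) : ℝ) < ((w (Sum.inr 1) : ℤ) : ℝ) * ((Complex.re ∘ (fun u : τ → ℤ => f (fun s => u (ρ s)))) ∘ fun w' s => w' (Sum.inl s)) w} ∧ (∅ : Set ℤ).Definable Language.ring {w : _ ⊕ Fin 2 → ℤ | 0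 < w (Sum.inr 1) ∧ ((w (Sum.inr 0) : ℤ) : ℝ) < ((w (Sum.inr 1) : ℤ) : ℝ) * ((Complex.im ∘ (fun u : τ → ℤ => f (fun s => u (ρ s)))) ∘ fun w' s => w' (Sum.inl s)) w}) :=
  ⟨defR_reindex hf.1 ρ, defR_reindex hf.2 ρ⟩

/-- **Gaussian-rational points with ring-definable integer coordinates**: `v ↦ (A v + B v · i) / C v` is a ring-definable
complex family (`C v = 0` gives `0`). [folklore] -/
theorem defC_testPoint {A B C : (σ → ℤ) → ℤ} (hA : (∅ : Set ℤ).DefinableFun Language.ring A)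
    (hB : (∅ : Set ℤ).DefinableFun Language.ring B) (hC : (∅ : Set ℤ).DefinableFun Language.ring C) :
    ((∅ : Set ℤ).Definable Language.ring {w : _ ⊕ Fin 2 → ℤ | 0 < w (Sum.inr 1) ∧ ((w (Sum.inr 0) : ℤ) : ℝ) < ((w (Sum.inr 1) : ℤ) : ℝ) * ((Complex.re ∘ (fun v => ((A v : ℂ) + (B v : ℂ) * Complex.I) / (C v : ℂ))) ∘ fun w' s => w' (Sum.inl s)) w} ∧ (∅ : Set ℤ).Definable Language.ring {w : _ ⊕ Fin 2 → ℤ | 0 < w (Sum.inr 1) ∧ ((w (Sum.inr 0) : ℤ) : ℝ) < ((w (Sum.inr 1) : ℤ) : ℝ) * ((Complex.im ∘ (fun v => ((A v : ℂ) + (B v : ℂ) * Complex.I) / (C v : ℂ))) ∘ fun w' s => w' (Sum.inl s)) w}) := by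
  have e : ∀ v, ((A v : ℂ) + (B v : ℂ) * Complex.I) / (C v : ℂ) = ⟨(A v : ℝ) / (C v : ℝ), (B v : ℝ) / (C v : ℝ)⟩ := by
    intro v
    rw [← Complex.ofReal_intCast (C v)]
    apply Complex.ext
    · rw [Complex.div_ofReal_re]; simp
    · rw [Complex.div_ofReal_im]; simp
  exact ⟨defR_congr (defR_ratio hA hC) fun v => by simp [e], defR_congr (defR_ratio hB hC) fun v => by simp [e]⟩

/-- An integer-valued ring-definable function, read in `ℂ`, is a ring-definable complex family. [folklore] -/
theorem defC_intCast {N : (σ → ℤ) → ℤ} (hN : (∅ : Set ℤ).DefinableFun Language.ring N) :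
    ((∅ : Set ℤ).Definable Language.ring {w : _ ⊕ Fin 2 → ℤ | 0 < w (Sum.inr 1) ∧ ((w (Sum.inr 0) : ℤ) : ℝ) < ((w (Sum.inr 1) : ℤ) : ℝ) * ((Complex.re ∘ (fun v => (N v : ℂ))) ∘ fun w' s => w' (Sum.inl s)) w} ∧ (∅ : Set ℤ).Definable Language.ring {w : _ ⊕ Fin 2 → ℤ | 0 < w (Sum.inr 1) ∧ ((w (Sum.inr 0) : ℤ) : ℝ) < ((w (Sum.inr 1) : ℤ) : ℝ) * ((Complex.im ∘ (fun v => (N v : ℂ))) ∘ fun w' s => w' (Sum.inl s)) w}) :=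
  ⟨defR_congr (defR_intCast hN) fun v => by simp,
    defR_congr (defR_intCast (ringDefinableFun_zero (α := σ))) fun v => by simp⟩

/-- A rational constant is a ring-definable complex family. [folklore] -/
theorem defC_ratCast (q : ℚ) : ((∅ : Set ℤ).Definable Language.ring {w : _ ⊕ Fin 2 → ℤ | 0 < w (Sum.inr 1) ∧ ((w (Sum.inr 0) : ℤ) : ℝ) < ((w (Sum.inr 1) : ℤ) : ℝ) * ((Complex.re ∘ (fun _ : σ → ℤ => (q : ℂ))) ∘ fun w' s => w' (Sum.inl s)) w} ∧ (∅ : Set ℤ).Definable Language.ring {w : _ ⊕ Fin 2 → ℤ | 0 < w (Sum.inr 1) ∧ ((w (Sum.inr 0) : ℤ) : ℝ) < ((w (Sum.inr 1) : ℤ) : ℝ) * ((Complex.im ∘ (fun _ : σ → ℤ => (q : ℂ))) ∘ fun w' s => w' (Sum.inl s)) w}) :=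
  ⟨defR_congr (defR_ratCast (σ := σ) q) fun v => by simp,
    defR_congr (defR_intCast (ringDefinableFun_zero (α := σ))) fun v => by simp⟩

/-- A ring-definable real family read in `ℂ` is a ring-definable complex family. [folklore] -/
theorem defC_ofReal {f : (σ → ℤ) → ℝ} (hf : (∅ : Set ℤ).Definable Language.ring {w : _ ⊕ Fin 2 → ℤ | 0 < w (Sum.inr 1) ∧ ((w (Sum.inr 0) : ℤ) : ℝ) < ((w (Sum.inr 1) : ℤ) : ℝ) * (f ∘ fun w' s => w' (Sum.inl s)) w}) : ((∅ : Set ℤ).Definable Language.ring {w : _ ⊕ Fin 2 → ℤ | 0 < w (Sum.inr 1) ∧ ((w (Sum.inr 0) : ℤ) : ℝ) < ((w (Sum.inr 1) : ℤ) : ℝ) * ((Complex.re ∘ (fun v => ((f v : ℝ) : ℂ))) ∘ fun w' s => w' (Sum.inl s)) w} ∧ (∅ : Set ℤ).Definable Language.ring {w : _ ⊕ Fin 2 → ℤ | 0 < w (Sum.inr 1) ∧ ((w (Sum.inr 0) : ℤ) : ℝ) < ((w (Sum.inr 1) : ℤ) : ℝ) * ((Complex.im ∘ (fun v => ((f v :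 ℝ) : ℂ))) ∘ fun w' s => w' (Sum.inl s)) w}) :=
  ⟨defR_congr hf fun v => by simp, defR_congr (defR_intCast (ringDefinableFun_zero (α := σ))) fun v => by simp⟩

/-- The constant `i` is a ring-definable complex family. [folklore] -/
theorem defC_I : ((∅ : Set ℤ).Definable Language.ring {w : _ ⊕ Fin 2 → ℤ | 0 < w (Sum.inr 1) ∧ ((w (Sum.inr 0) : ℤ) : ℝ) < ((w (Sum.inr 1) : ℤ) : ℝ) * ((Complex.re ∘ (fun _ : σ → ℤ => Complex.I)) ∘ fun w' s => w' (Sum.inl s)) w} ∧ (∅ : Set ℤ).Definable Language.ring {w : _ ⊕ Fin 2 → ℤ | 0 < w (Sum.inr 1) ∧ ((w (Sum.inr 0) : ℤ) : ℝ) < ((w (Sum.inr 1) : ℤ) : ℝ) * ((Complex.im ∘ (fun _ : σ → ℤ => Complex.I)) ∘ fun w' s => w' (Sum.inl s)) w}) :=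
  ⟨defR_congr (defR_intCast (ringDefinableFun_zero (α := σ))) fun v => by simp,
    defR_congr (defR_intCast (ringDefinableFun_one (α := σ))) fun v => by simp⟩

/-- Sums of ring-definable complex families. [folklore] -/
theorem defC_add {f g : (σ → ℤ) → ℂ} (hf : ((∅ : Set ℤ).Definable Language.ring {w : _ ⊕ Fin 2 → ℤ | 0 < w (Sum.inr 1) ∧ ((w (Sum.inr 0) : ℤ) : ℝ) < ((w (Sum.inr 1) : ℤ) : ℝ) * ((Complex.re ∘ f) ∘ fun w' s => w' (Sum.inl s)) w} ∧ (∅ : Set ℤ).Definable Language.ring {w : _ ⊕ Fin 2 → ℤ | 0 < w (Sum.inr 1) ∧ ((w (Sum.inr 0) : ℤ) : ℝ) < ((w (Sum.inr 1) : ℤ) : ℝ) * ((Complex.im ∘ f) ∘ fun w' s => w' (Sum.inl s)) w})) (hg : ((∅ : Set ℤ).Definable Language.ring {w : _ ⊕ Fin 2 → ℤ | 0 < w (Sum.inr 1) ∧ ((w (Sum.inr 0) : ℤ) : ℝ) < ((w (Sum.inr 1) : ℤ) : ℝ) * ((Complex.re ∘ g) ∘ fun w' s => w' (Sum.inl s))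 w} ∧ (∅ : Set ℤ).Definable Language.ring {w : _ ⊕ Fin 2 → ℤ | 0 < w (Sum.inr 1) ∧ ((w (Sum.inr 0) : ℤ) : ℝ) < ((w (Sum.inr 1) : ℤ) : ℝ) * ((Complex.im ∘ g) ∘ fun w' s => w' (Sum.inl s)) w})) : ((∅ : Set ℤ).Definable Language.ring {w : _ ⊕ Fin 2 → ℤ | 0 < w (Sum.inr 1) ∧ ((w (Sum.inr 0) : ℤ) : ℝ) < ((w (Sum.inr 1) : ℤ) : ℝ) * ((Complex.re ∘ (fun v => f v + g v)) ∘ fun w' s => w' (Sum.inl s)) w} ∧ (∅ : Set ℤ).Definable Language.ring {w : _ ⊕ Fin 2 → ℤ | 0 < w (Sum.inr 1) ∧ ((w (Sum.inr 0) : ℤ) : ℝ) < ((w (Sum.inr 1) : ℤ) : ℝ) * ((Complex.im ∘ (fun v => f v + g v)) ∘ fun w' s => w' (Sum.inl s)) w}) :=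
  ⟨defR_congr (defR_add hf.1 hg.1) fun v => by simp, defR_congr (defR_add hf.2 hg.2) fun v => by simp⟩

/-- Negations of ring-definable complex families. [folklore] -/
theorem defC_neg {f : (σ → ℤ) → ℂ} (hf : ((∅ : Set ℤ).Definable Language.ring {w : _ ⊕ Fin 2 → ℤ | 0 < w (Sum.inr 1) ∧ ((w (Sum.inr 0) : ℤ) : ℝ) < ((w (Sum.inr 1) : ℤ) : ℝ) * ((Complex.re ∘ f) ∘ fun w' s => w' (Sum.inl s)) w} ∧ (∅ : Set ℤ).Definable Language.ring {w : _ ⊕ Fin 2 → ℤ | 0 < w (Sum.inr 1) ∧ ((w (Sum.inr 0) : ℤ) : ℝ) < ((w (Sum.inr 1) : ℤ) : ℝ) * ((Complex.im ∘ f) ∘ fun w' s => w' (Sum.inl s)) w})) : ((∅ : Set ℤ).Definable Language.ring {w : _ ⊕ Fin 2 → ℤ | 0 < w (Sum.inr 1) ∧ ((w (Sum.inr 0) : ℤ) : ℝ) < ((w (Sum.inr 1) : ℤ) : ℝ) * ((Complex.re ∘ (fun v => -f v)) ∘ fun w' s => w' (Sum.inl s)) w} ∧ (∅ : Set ℤ).Definable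 Language.ring {w : _ ⊕ Fin 2 → ℤ | 0 < w (Sum.inr 1) ∧ ((w (Sum.inr 0) : ℤ) : ℝ) < ((w (Sum.inr 1) : ℤ) : ℝ) * ((Complex.im ∘ (fun v => -f v)) ∘ fun w' s => w' (Sum.inl s)) w}) :=
  ⟨defR_congr (defR_neg hf.1) fun v => by simp, defR_congr (defR_neg hf.2) fun v => by simp⟩

/-- Differences of ring-definable complex families. [folklore] -/
theorem defC_sub {f g : (σ → ℤ) → ℂ} (hf : ((∅ : Set ℤ).Definable Language.ring {w : _ ⊕ Fin 2 → ℤ | 0 < w (Sum.inr 1) ∧ ((w (Sum.inr 0) : ℤ) : ℝ) < ((w (Sum.inr 1) : ℤ) : ℝ) * ((Complex.re ∘ f) ∘ fun w' s => w' (Sum.inl s)) w} ∧ (∅ : Set ℤ).Definable Language.ring {w : _ ⊕ Fin 2 → ℤ | 0 < w (Sum.inr 1) ∧ ((w (Sum.inr 0) : ℤ) : ℝ) < ((w (Sum.inr 1) : ℤ) : ℝ) * ((Complex.im ∘ f) ∘ fun w' s => w' (Sum.inl s)) w})) (hg : ((∅ : Set ℤ).Definable Language.ring {w : _ ⊕ Fin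 2 → ℤ | 0 < w (Sum.inr 1) ∧ ((w (Sum.inr 0) : ℤ) : ℝ) < ((w (Sum.inr 1) : ℤ) : ℝ) * ((Complex.re ∘ g) ∘ fun w' s => w' (Sum.inl s)) w} ∧ (∅ : Set ℤ).Definable Language.ring {w : _ ⊕ Fin 2 → ℤ | 0 < w (Sum.inr 1) ∧ ((w (Sum.inr 0) : ℤ) : ℝ) < ((w (Sum.inr 1) : ℤ) : ℝ) * ((Complex.im ∘ g) ∘ fun w' s => w' (Sum.inl s)) w})) : ((∅ : Set ℤ).Definable Language.ring {w : _ ⊕ Fin 2 → ℤ | 0 < w (Sum.inr 1) ∧ ((w (Sum.inr 0) : ℤ) : ℝ) < ((w (Sum.inr 1) : ℤ) : ℝ) * ((Complex.re ∘ (fun v => f v - g v)) ∘ fun w' s => w' (Sum.inl s)) w} ∧ (∅ : Set ℤ).Definable Language.ring {w : _ ⊕ Fin 2 → ℤ | 0 < w (Sum.inr 1) ∧ ((w (Sum.inr 0) : ℤ) : ℝ) < ((w (Sum.inr 1) : ℤ) : ℝ) * ((Complex.im ∘ (fun v => f v - g v)) ∘ fun w' s => w' (Sum.inl s)) w}) 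:=
  defC_congr (defC_add hf (defC_neg hg)) fun v => by simp [sub_eq_add_neg]

/-- Products of ring-definable complex families (`(f g).re = f.re g.re − f.im g.im`, …). [folklore] -/
theorem defC_mul {f g : (σ → ℤ) → ℂ} (hf : ((∅ : Set ℤ).Definable Language.ring {w : _ ⊕ Fin 2 → ℤ | 0 < w (Sum.inr 1) ∧ ((w (Sum.inr 0) : ℤ) : ℝ) < ((w (Sum.inr 1) : ℤ) : ℝ) * ((Complex.re ∘ f) ∘ fun w' s => w' (Sum.inl s)) w} ∧ (∅ : Set ℤ).Definable Language.ring {w : _ ⊕ Fin 2 → ℤ | 0 < w (Sum.inr 1) ∧ ((w (Sum.inr 0) : ℤ) : ℝ) < ((w (Sum.inr 1) : ℤ) : ℝ) * ((Complex.im ∘ f) ∘ fun w' s => w' (Sum.inl s)) w})) (hg : ((∅ : Set ℤ).Definable Language.ring {w : _ ⊕ Fin 2 → ℤ | 0 < w (Sum.inr 1) ∧ ((w (Sum.inr 0) : ℤ) : ℝ) < ((w (Sum.inr 1) : ℤ) : ℝ) * ((Complex.re ∘ g) ∘ fun w' s => w' (Sum.inl s)) w} ∧ (∅ : Set ℤ).Definable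 Language.ring {w : _ ⊕ Fin 2 → ℤ | 0 < w (Sum.inr 1) ∧ ((w (Sum.inr 0) : ℤ) : ℝ) < ((w (Sum.inr 1) : ℤ) : ℝ) * ((Complex.im ∘ g) ∘ fun w' s => w' (Sum.inl s)) w})) : ((∅ : Set ℤ).Definable Language.ring {w : _ ⊕ Fin 2 → ℤ | 0 < w (Sum.inr 1) ∧ ((w (Sum.inr 0) : ℤ) : ℝ) < ((w (Sum.inr 1) : ℤ) : ℝ) * ((Complex.re ∘ (fun v => f v * g v)) ∘ fun w' s => w' (Sum.inl s)) w} ∧ (∅ : Set ℤ).Definable Language.ring {w : _ ⊕ Fin 2 → ℤ | 0 < w (Sum.inr 1) ∧ ((w (Sum.inr 0) : ℤ) : ℝ) < ((w (Sum.inr 1) : ℤ) : ℝ) * ((Complex.im ∘ (fun v => f v * g v)) ∘ fun w' s => w' (Sum.inl s)) w}) :=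
  ⟨defR_congr (defR_sub (defR_mul hf.1 hg.1) (defR_mul hf.2 hg.2)) fun v => by simp,
    defR_congr (defR_add (defR_mul hf.1 hg.2) (defR_mul hf.2 hg.1)) fun v => by simp⟩

/-- Finite sums of ring-definable complex families. [folklore] -/
theorem defC_sum {ι : Type*} (s : Finset ι) {F : ι → (σ → ℤ) → ℂ} (hF : ∀ i ∈ s, ((∅ : Set ℤ).Definable Language.ring {w : _ ⊕ Fin 2 → ℤ | 0 < w (Sum.inr 1) ∧ ((w (Sum.inr 0) : ℤ) : ℝ) < ((w (Sum.inr 1) : ℤ) : ℝ) * ((Complex.re ∘ (F i)) ∘ fun w' s => w' (Sum.inl s)) w} ∧ (∅ : Set ℤ).Definable Language.ring {w : _ ⊕ Fin 2 → ℤ | 0 < w (Sum.inr 1) ∧ ((w (Sum.inr 0) : ℤ) : ℝ) < ((w (Sum.inr 1) : ℤ) : ℝ) * ((Complex.im ∘ (F i)) ∘ fun w' s => w' (Sum.inl s)) w})) :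
    ((∅ : Set ℤ).Definable Language.ring {w : _ ⊕ Fin 2 → ℤ | 0 < w (Sum.inr 1) ∧ ((w (Sum.inr 0) : ℤ) : ℝ) < ((w (Sum.inr 1) : ℤ) : ℝ) * ((Complex.re ∘ (fun v => ∑ i ∈ s, F i v)) ∘ fun w' s => w' (Sum.inl s)) w} ∧ (∅ : Set ℤ).Definable Language.ring {w : _ ⊕ Fin 2 → ℤ | 0 < w (Sum.inr 1) ∧ ((w (Sum.inr 0) : ℤ) : ℝ) < ((w (Sum.inr 1) : ℤ) : ℝ) * ((Complex.im ∘ (fun v => ∑ i ∈ s, F i v)) ∘ fun w' s => w' (Sum.inl s)) w}) :=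
  ⟨defR_congr (defR_sum s (fun i hi => (hF i hi).1)) fun v => by simp [Complex.re_sum],
    defR_congr (defR_sum s (fun i hi => (hF i hi).2)) fun v => by simp [Complex.im_sum]⟩

/-- Natural powers of a ring-definable complex family. [folklore] -/
theorem defC_pow {f : (σ → ℤ) → ℂ} (hf : ((∅ : Set ℤ).Definable Language.ring {w : _ ⊕ Fin 2 → ℤ | 0 < w (Sum.inr 1) ∧ ((w (Sum.inr 0) : ℤ) : ℝ) < ((w (Sum.inr 1) : ℤ) : ℝ) * ((Complex.re ∘ f) ∘ fun w' s => w' (Sum.inl s)) w} ∧ (∅ : Set ℤ).Definable Language.ring {w : _ ⊕ Fin 2 → ℤ | 0 < w (Sum.inr 1) ∧ ((w (Sum.inr 0) : ℤ) : ℝ) < ((w (Sum.inr 1) : ℤ) : ℝ) * ((Complex.im ∘ f) ∘ fun w' s => w' (Sum.inl s)) w})) (n : ℕ) : ((∅ : Set ℤ).Definable Language.ring {w : _ ⊕ Fin 2 → ℤ | 0 < w (Sum.inr 1) ∧ ((w (Sum.inr 0) : ℤ) : ℝ) < ((w (Sum.inr 1) : ℤ) : ℝ) * ((Complex.re ∘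 (fun v => f v ^ n)) ∘ fun w' s => w' (Sum.inl s)) w} ∧ (∅ : Set ℤ).Definable Language.ring {w : _ ⊕ Fin 2 → ℤ | 0 < w (Sum.inr 1) ∧ ((w (Sum.inr 0) : ℤ) : ℝ) < ((w (Sum.inr 1) : ℤ) : ℝ) * ((Complex.im ∘ (fun v => f v ^ n)) ∘ fun w' s => w' (Sum.inl s)) w}) := by
  induction n with
  | zero => exact defC_congr (defC_ratCast (σ := σ) 1) fun v => by simp
  | succ n ih => exact defC_congr (defC_mul ih hf) fun v => by simp [pow_succ]

/-- **The squared norm of a ring-definable complex family is a ring-definable real family.** [folklore] -/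
theorem defR_normSq {f : (σ → ℤ) → ℂ} (hf : ((∅ : Set ℤ).Definable Language.ring {w : _ ⊕ Fin 2 → ℤ | 0 < w (Sum.inr 1) ∧ ((w (Sum.inr 0) : ℤ) : ℝ) < ((w (Sum.inr 1) : ℤ) : ℝ) * ((Complex.re ∘ f) ∘ fun w' s => w' (Sum.inl s)) w} ∧ (∅ : Set ℤ).Definable Language.ring {w : _ ⊕ Fin 2 → ℤ | 0 < w (Sum.inr 1) ∧ ((w (Sum.inr 0) : ℤ) : ℝ) < ((w (Sum.inr 1) : ℤ) : ℝ) * ((Complex.im ∘ f) ∘ fun w' s => w' (Sum.inl s)) w})) : (∅ : Set ℤ).Definable Language.ring {w : _ ⊕ Fin 2 → ℤ | 0 < w (Sum.inr 1) ∧ ((w (Sum.inr 0) : ℤ) : ℝ) < ((w (Sum.inr 1) : ℤ) : ℝ) * ((fun v => Complex.normSq (f v)) ∘ fun w' s => w' (Sum.inl s)) w} :=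
  defR_congr (defR_add (defR_mul hf.1 hf.1) (defR_mul hf.2 hf.2)) fun v => by simp [Complex.normSq_apply]

/-! ## Evaluation of fixed rational polynomials -/

/-- **Evaluation of a fixed multivariate rational polynomial at ring-definable complex families is ring-definable**
(induction on the polynomial: constants, sums, multiplication by a variable). [folklore] -/
theorem defC_mvPolynomial_aeval {ι : Type*} (p : MvPolynomial ι ℚ) {X : ι → (σ → ℤ) → ℂ} (hX : ∀ i, ((∅ : Set ℤ).Definable Language.ring {w : _ ⊕ Fin 2 → ℤ | 0 < w (Sum.inr 1) ∧ ((w (Sum.inr 0) : ℤ) : ℝ) < ((w (Sum.inr 1) : ℤ) : ℝ) * ((Complex.re ∘ (X i)) ∘ fun w' s => w' (Sum.inl s)) w} ∧ (∅ : Set ℤ).Definable Language.ring {w : _ ⊕ Fin 2 → ℤ | 0 < w (Sum.inr 1) ∧ ((w (Sum.inr 0) : ℤ) : ℝ) < ((w (Sum.inr 1) : ℤ) : ℝ) * ((Complex.im ∘ (X i)) ∘ fun w' s => w' (Sum.inl s)) w})) :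
    ((∅ : Set ℤ).Definable Language.ring {w : _ ⊕ Fin 2 → ℤ | 0 < w (Sum.inr 1) ∧ ((w (Sum.inr 0) : ℤ) : ℝ) < ((w (Sum.inr 1) : ℤ) : ℝ) * ((Complex.re ∘ (fun v => MvPolynomial.aeval (fun i => X i v) p)) ∘ fun w' s => w' (Sum.inl s)) w} ∧ (∅ : Set ℤ).Definable Language.ring {w : _ ⊕ Fin 2 → ℤ | 0 < w (Sum.inr 1) ∧ ((w (Sum.inr 0) : ℤ) : ℝ) < ((w (Sum.inr 1) : ℤ) : ℝ) * ((Complex.im ∘ (fun v => MvPolynomial.aeval (fun i => X i v) p)) ∘ fun w' s => w' (Sum.inl s)) w}) := by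
  induction p using MvPolynomial.induction_on with
  | C a => exact defC_congr (defC_ratCast (σ := σ) a) fun v => by simp
  | add p q hp hq => exact defC_congr (defC_add hp hq) fun v => by simp [map_add]
  | mul_X p i hp => exact defC_congr (defC_mul hp (hX i)) fun v => by simp [map_mul, MvPolynomial.aeval_X]

/-- Evaluation of a fixed univariate rational polynomial at a ring-definable complex family is ring-definable. [folklore] -/
theorem defC_polynomial_aeval (p : Polynomial ℚ) {f : (σ → ℤ) → ℂ} (hf : ((∅ : Set ℤ).Definable Language.ring {w : _ ⊕ Fin 2 → ℤ | 0 < w (Sum.inr 1) ∧ ((w (Sum.inr 0) : ℤ) : ℝ) < ((w (Sum.inr 1) : ℤ) : ℝ) * ((Complex.re ∘ f) ∘ fun w' s => w' (Sum.inl s)) w} ∧ (∅ : Set ℤ).Definable Language.ring {w : _ ⊕ Fin 2 → ℤ | 0 < w (Sum.inr 1) ∧ ((w (Sum.inr 0) : ℤ) : ℝ) < ((w (Sum.inr 1) : ℤ) : ℝ) * ((Complex.im ∘ f) ∘ fun w' s => w' (Sum.inl s)) w})) :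
    ((∅ : Set ℤ).Definable Language.ring {w : _ ⊕ Fin 2 → ℤ | 0 < w (Sum.inr 1) ∧ ((w (Sum.inr 0) : ℤ) : ℝ) < ((w (Sum.inr 1) : ℤ) : ℝ) * ((Complex.re ∘ (fun v => Polynomial.aeval (f v) p)) ∘ fun w' s => w' (Sum.inl s)) w} ∧ (∅ : Set ℤ).Definable Language.ring {w : _ ⊕ Fin 2 → ℤ | 0 < w (Sum.inr 1) ∧ ((w (Sum.inr 0) : ℤ) : ℝ) < ((w (Sum.inr 1) : ℤ) : ℝ) * ((Complex.im ∘ (fun v => Polynomial.aeval (f v) p)) ∘ fun w' s => w' (Sum.inl s)) w}) := by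
  induction p using Polynomial.induction_on' with
  | add p q hp hq => exact defC_congr (defC_add hp hq) fun v => by simp [map_add]
  | monomial n a =>
    exact defC_congr (defC_mul (defC_ratCast (σ := σ) a) (defC_pow hf n)) fun v => by
      simp [Polynomial.aeval_monomial]

/-! ## Registered form -/

omit [FirstOrder.Ring.CompatibleRing ℤ] in
/-- Registered helper stub `ringDefinable_realCut_mul` of crux stmt-Schanuel-0969 (line kernel-arithmetic-selection, S8‴):
**the product of two families of reals with ring-definable lower rational cuts has a ring-definable lower rational cut**
(interval multiplication by corner values, inside first-order arithmetic). [folklore] -/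
theorem ringDefinable_realCut_mul : ∀ [FirstOrder.Ring.CompatibleRing ℤ] (k : ℕ) (f g : (Fin k → ℤ) → ℝ), (∅ : Set ℤ).Definable FirstOrder.Language.ring {w : Fin k ⊕ Fin 2 → ℤ | 0 < w (Sum.inr 1) ∧ ((w (Sum.inr 0) : ℤ) : ℝ) < ((w (Sum.inr 1) : ℤ) : ℝ) * f (fun s => w (Sum.inl s))} → (∅ : Set ℤ).Definable FirstOrder.Language.ring {w : Fin k ⊕ Fin 2 → ℤ | 0 < w (Sum.inr 1) ∧ ((w (Sum.inr 0) : ℤ) : ℝ) < ((w (Sum.inr 1) : ℤ) : ℝ) * g (fun s => w (Sum.inl s))} → (∅ : Set ℤ).Definable FirstOrder.Language.ring {w : Fin k ⊕ Fin 2 → ℤ | 0 < w (Sum.inr 1) ∧ ((w (Sum.inr 0) : ℤ) : ℝ) < ((w (Sum.inr 1) : ℤ) : ℝ) * (f (fun s => w (Sum.inl s)) * g (fun s => w (Sum.inl s)))} := by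
  intro _ k f g hf hg
  exact defR_mul hf hg

end Summit.Schanuel.Schanuel.Cruxes.MinimalCounterexampleInAcl.KernelArithmeticSelection
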